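import Summits.BirchSwinnertonDyer.BirchSwinnertonDyer.Theorems.EisensteinPrimesMazurMCOnCellBEtaleEndLocalSplitting
import Summits.BirchSwinnertonDyer.Rank1Residual.GaloisImage.ThreeTorsionCubeRootDelta
import Summits.BirchSwinnertonDyer.Rank1Residual.GaloisImage.CubicKummerIndependence
import HarnessLib

/-!
# Crux `MazurMCOnCellB` (stmt-BirchSwinnertonDyer-19033), line `mudescent` v4 — the étale end at
# `p = 3`: a cube root of `Δ` fixed by `D_3`, so `Δ_min ∈ (ℚ₃^×)³`; members with `Δ_min ∉ (ℚ₃^×)³`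
# lie ON the barrier locus

Width seat bsd-line-x2-p1-w2 (gen 5), `--supports -19033`, μ-lineage; sequel of
`…EisensteinPrimesMazurMCOnCellBEtaleEndLocalSplitting` (§2 there: `ρ̄_{E,3}(D_3)` has exponent `2` at
an unramified rational `3`-line). THEOREMS ONLY (no definition, no named fact, no `sorry`); nothing
here proves a main conjecture, closes a stub or moves a label. This is the kernel form of the
«cube criterion» of -w2 g4's `ADDENDUM-cube-criterion.md` (there: numerics + sketch only).

* §1 `exists_cubeRoot_Δ_decomp_fix_of_lineUnramifiedAt_three` — for `W/ℚ` globally minimal,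
  multiplicative at `3`, `Φ` a rational `3`-line UNRAMIFIED at `3`, `v ∋ 3`: some cube root of `Δ(W)`
  in `ℚ̄` is FIXED by `D_v` (the cube roots lie in `ℚ(E[3])`, Serre 1972 §5.3 = tree
  `exists_cubeRoots_Δ_mem_divisionField_three`, on which every `g ∈ D_v` squares to `1`; an
  exponent-`2` group acting on a `3`-set has a fixed point — done by hand with the Kummer characters
  `g ↦ g(δ)/δ ∈ μ₃`); hence `exists_adicCompletion_pow_three_eq_Δ_…` (Galois descent in `ℚ̄_v`) and
  `exists_padic_pow_three_eq_Δ_…` (Mathlib `Padic.adicCompletionEquiv`): **`Δ(W) ∈ (ℚ₃^×)³`**.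
* §2 the ÉTALE END at `p = 3`, type A off the locus (`¬ GVPar`, `¬ HasRamifiedOddLineAt`; rows A10 =
  `X2.CellB` and B11 = `X2.CellC`): **`Δ_min ∈ (ℚ₃^×)³`** (`…_of_notGVPar_offLocus`,
  `…_of_cellB_offLocus`, `…_of_cellC_offLocus`); contrapositive `hasRamifiedOddLineAt_of_not_cube`, and
  `one_le_mu_of_notGVPar_of_not_cube` (**`Δ_min ∉ (ℚ₃^×)³ ⟹ μ(X(E/ℚ_∞)) ≥ 1`** for every torsion
  cyclotomic Selmer dual datum, relative to Greenberg's Prop. 5.7 through `EisensteinMuBarrier.one_le_mu`)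
  — a second free census column next to `3 ∤ v₃(Δ_min)` (`…EtaleEndAtP.one_le_mu_of_notGVPar_of_not_dvd`);
  elementary reading `3 ∣ v₃(Δ_min) ∧ (unit part of Δ_min) ≡ ±1 (mod 9)`, no division polynomial.

CENSUS of record (-w2 g4 `ADDENDUM-cube-criterion.md` 4694fe914720b0d5, Cremona `allcurves`, the 127
A10 classes at `p = 3`): `Δ_min ∈ (ℚ₃^×)³` on 147/147 étale-side members vs 10/150 on-locus members.
HONEST FRAMING: structure of the étale end only; stub 3′ (`μ_an ≤ μ_alg` there) stays OPEN
class-wide (Vatsal, J. Inst. Math. Jussieu 4 (2005) Thm. 1.16 and p. 11); no summit statement, no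
main conjecture / BSD for any curve is proved here; 0 cells / labels move.

References: [Serre1972] §5.3 (`ℚ(E[3]) ⊇ ℚ(μ₃, ∛Δ)`); [SilvermanATAEC1994] §V.5 Thm. 5.3, Cor. 5.4,
§V.6 Prop. 6.1; [GreenbergVatsal2000] §2 pp. 14–15, p. 28; [GreenbergLNM1716] Prop. 5.7 (p. 113).
-/

set_option autoImplicit false

-- `Summit.BirchSwinnertonDyer.BirchSwinnertonDyer.…`: the summit and its single sub-problem share a name (D-0017 layout).
set_option linter.dupNamespace false

noncomputable section

open scoped Classical NumberField

open WeierstrassCurve NumberField IsDedekindDomain Field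
  Literature.NumberTheory.EllipticCurves
  Literature.NumberTheory.EllipticCurves.Rank1Residual
  Literature.NumberTheory.GaloisRepresentations
  Literature.NumberTheory.EllipticCurves.GreenbergSelmer
  Literature.Barriers.BirchSwinnertonDyer
  Summit.BirchSwinnertonDyer.Rank1Residual
  Summit.BirchSwinnertonDyer.Rank1Residual.X2.GreenbergVatsalTateDatum
  Summit.BirchSwinnertonDyer.Rank1Residual.X2.GreenbergVatsalTateDatumSign
  Summit.BirchSwinnertonDyer.Rank1Residual.X2.GreenbergVatsalTateDatumTorsion
  Summit.BirchSwinnertonDyer.Rank1Residual.X2.GreenbergVatsalTateDatumCofree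
  Summit.BirchSwinnertonDyer.Rank1Residual.X2.TateLineDecomposition
  Summit.BirchSwinnertonDyer.BirchSwinnertonDyer.Theorems.EisensteinPrimesMazurMCOnCellBEtaleEndLocalSplitting

namespace Summit.BirchSwinnertonDyer.BirchSwinnertonDyer.Theorems.EisensteinPrimesMazurMCOnCellBEtaleEndCube

variable {W : WeierstrassCurve ℚ} [W.IsElliptic] [W.IsGloballyMinimal] {p : ℕ} [hp : Fact p.Prime]

/-! ## §1 `p = 3`: a cube root of `Δ` fixed by `D_v` — `Δ(W) ∈ (ℚ₃^×)³` at every type-A étale end -/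

/-- Cube roots of unity: if `ω² + ω + 1 = 0` then every `u ≠ 1` with `u³ = 1` is `ω` or `ω²`
(`X² + X + 1 = (X − ω)(X − ω²)`). [folklore] -/
theorem eq_or_eq_sq_of_pow_three_eq_one {K : Type*} [Field K] {ω u : K} (hω : ω ^ 2 + ω + 1 = 0)
    (hu : u ^ 3 = 1) (hu1 : u ≠ 1) : u = ω ∨ u = ω ^ 2 := by
  have hu' : (u - 1) * (u ^ 2 + u + 1) = 0 := by linear_combination hu
  have h2 : u ^ 2 + u + 1 = 0 := (mul_eq_zero.mp hu').resolve_left (sub_ne_zero.mpr hu1)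
  have h : (u - ω) * (u - ω ^ 2) = 0 := by linear_combination h2 + (ω - 1 - u) * hω
  rcases mul_eq_zero.mp h with h | h
  · exact Or.inl (sub_eq_zero.mp h)
  · exact Or.inr (sub_eq_zero.mp h)

/-- A Galois element squaring to the identity on a cube root `t ≠ 0` of a fixed element, and moving
`t` through the cube root of unity `u` (`g t = u t`), INVERTS `u`: `g u = u²`. [folklore] -/
theorem smul_eq_sq_of_smul_smul_eq {g : absoluteGaloisGroup ℚ} {u t : AlgebraicClosure ℚ}
    (ht : t ≠ 0) (hu : u ^ 3 = 1) (hgt : g • t = u * t) (hgg : g • g • t = t) : g • u = u ^ 2 := by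
  rw [hgt, smul_mul', hgt, ← mul_assoc] at hgg
  have h2 : (g • u) * u = 1 := mul_right_cancel₀ ht (hgg.trans (one_mul t).symm)
  calc g • u = (g • u) * (u * u ^ 2) := by rw [← pow_succ', hu, mul_one]
    _ = ((g • u) * u) * u ^ 2 := by ring
    _ = u ^ 2 := by rw [h2, one_mul]

/-- **`p = 3`: a cube root of `Δ` FIXED by the decomposition group.** For `W/ℚ` globally minimal
with multiplicative reduction at `3` and a rational `3`-line `Φ` UNRAMIFIED at `3`, and `v ∋ 3`:
some `δ ∈ ℚ̄` with `δ³ = Δ(W)` is fixed by every `g ∈ D_v`. Proof: the three cube roots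
`δ, ωδ, ω²δ` lie in `ℚ(E[3])` (Serre 1972 §5.3, tree `exists_cubeRoots_Δ_mem_divisionField_three`)
and every `g ∈ D_v` squares to the identity on `E[3]` (§2), hence on these; if `g₀ ∈ D_v` moves
`δ`, `g₀ δ = u₀ δ` with `u₀` primitive and `g₀ u₀ = u₀²`, so `g₀` FIXES `δ₁ = u₀² δ`; a `g ∈ D_v`
moving `δ₁` (`g δ₁ = u δ₁`, `g u = u²`, `g₀ u = u²`) would give `(g₀g)² δ₁ = u δ₁ ≠ δ₁` —
contradiction. (Equivalently: an exponent-`2` group acting on a `3`-set has a fixed point.)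
[cite: Serre1972, §5.3] [cite: SilvermanATAEC1994, Ch. V Thm. 5.3, Cor. 5.4] -/
theorem exists_cubeRoot_Δ_decomp_fix_of_lineUnramifiedAt_three {W : WeierstrassCurve ℚ}
    [W.IsElliptic] [W.IsGloballyMinimal] (hmult : W.HasMultiplicativeReductionAtPrime 3)
    {Φ : AddSubgroup (geomTorsion W ((3 : ℕ) : ℤ))} (hΦ : IsRationalLine W 3 Φ)
    (hunr : LineUnramifiedAt W 3 Φ) {v : HeightOneSpectrum (𝓞 ℚ)}
    (hpv : ((3 : ℕ) : 𝓞 ℚ) ∈ v.asIdeal) :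
    ∃ δ : AlgebraicClosure ℚ, δ ^ 3 = algebraMap ℚ (AlgebraicClosure ℚ) W.Δ ∧
      ∀ g ∈ decomp (K := ℚ) v, g • δ = δ := by
  -- squares of elements of `D_v` fix `E[3]`, hence `ℚ(E[3])`, pointwise
  have hsq : ∀ g ∈ decomp (K := ℚ) v, ∀ x ∈ W.divisionField 3, g • g • x = x := by
    intro g hg x hx
    rw [← mul_smul]
    refine (W.mem_divisionField_iff 3).mp hx (g * g) fun T ↦ ?_
    rw [mul_smul]
    exact smul_smul_eq_of_lineUnramifiedAt_three hmult hΦ hunr hpv hg T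
  -- `Δ ∈ ℚ` is fixed by `Γ_ℚ`; the two `ℚ`-algebra structures on `ℚ̄` have the same `algebraMap`
  have hamap : ∀ f f' : ℚ →+* AlgebraicClosure ℚ, f W.Δ = f' W.Δ := fun f f' ↦ by
    rw [Subsingleton.elim f f']
  have hgΔ : ∀ g : absoluteGaloisGroup ℚ,
      g • algebraMap ℚ (AlgebraicClosure ℚ) W.Δ = algebraMap ℚ (AlgebraicClosure ℚ) W.Δ :=
    fun g ↦ smul_algebraMap g W.Δ
  have hΔ0 : algebraMap ℚ (AlgebraicClosure ℚ) W.Δ ≠ 0 := by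
    rw [Ne, map_eq_zero_iff _ (algebraMap ℚ (AlgebraicClosure ℚ)).injective]
    exact W.isUnit_Δ.ne_zero
  -- the cube roots of `Δ` inside `ℚ(E[3])`
  obtain ⟨ω, δ, hω, hδ', hδK, hωδK, hω2δK⟩ :=
    GaloisImage.exists_cubeRoots_Δ_mem_divisionField_three (W := W)
  have hδ : δ ^ 3 = algebraMap ℚ (AlgebraicClosure ℚ) W.Δ := hδ'.trans (hamap _ _)
  have hδ0 : δ ≠ 0 := by rintro rfl; exact hΔ0 (by rw [← hδ]; norm_num)
  have hω3 : ω ^ 3 = 1 := by linear_combination (ω - 1) * hω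
  by_cases hfix : ∀ g ∈ decomp (K := ℚ) v, g • δ = δ
  · exact ⟨δ, hδ, hfix⟩
  push Not at hfix
  obtain ⟨g₀, hg₀, hg₀δ⟩ := hfix
  obtain ⟨u₀, hu₀, hg₀u⟩ := GaloisImage.CubicKummer.exists_smul_eq_mul_of_pow_three_eq g₀ (hgΔ g₀) hδ
  have hu₀1 : u₀ ≠ 1 := fun h ↦ hg₀δ (by rw [hg₀u, h, one_mul])
  have hu₀0 : u₀ ≠ 0 := fun h ↦ by rw [h] at hu₀; norm_num at hu₀
  -- `g₀` inverts `u₀`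
  have hg₀u₀ : g₀ • u₀ = u₀ ^ 2 := smul_eq_sq_of_smul_smul_eq hδ0 hu₀ hg₀u (hsq g₀ hg₀ δ hδK)
  -- the root fixed by `g₀`
  set δ₁ : AlgebraicClosure ℚ := u₀ ^ 2 * δ with hδ₁
  have hδ₁3 : δ₁ ^ 3 = algebraMap ℚ (AlgebraicClosure ℚ) W.Δ := by
    rw [hδ₁, mul_pow, ← pow_mul, show 2 * 3 = 3 * 2 from rfl, pow_mul, hu₀, one_pow, one_mul, hδ]
  have hδ₁K : δ₁ ∈ W.divisionField 3 := by
    rcases eq_or_eq_sq_of_pow_three_eq_one hω hu₀ hu₀1 with h | h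
    · rw [hδ₁, h]; exact hω2δK
    · rw [hδ₁, h, ← pow_mul, show 2 * 2 = 3 + 1 from rfl, pow_succ, hω3, one_mul]; exact hωδK
  have hδ₁0 : δ₁ ≠ 0 := mul_ne_zero (pow_ne_zero _ hu₀0) hδ0
  have hg₀δ₁ : g₀ • δ₁ = δ₁ := by
    rw [hδ₁, smul_mul', smul_pow', hg₀u₀, hg₀u, ← pow_mul]
    calc u₀ ^ (2 * 2) * (u₀ * δ) = u₀ ^ 3 * (u₀ ^ 2 * δ) := by ring
      _ = u₀ ^ 2 * δ := by rw [hu₀, one_mul]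
  refine ⟨δ₁, hδ₁3, fun g hg ↦ ?_⟩
  by_contra hgδ₁
  obtain ⟨u, hu, hgu⟩ := GaloisImage.CubicKummer.exists_smul_eq_mul_of_pow_three_eq g (hgΔ g) hδ₁3
  have hu1 : u ≠ 1 := fun h ↦ hgδ₁ (by rw [hgu, h, one_mul])
  -- `g` inverts `u`; so does `g₀` (`u ∈ {u₀, u₀²}`)
  have hguu : g • u = u ^ 2 := smul_eq_sq_of_smul_smul_eq hδ₁0 hu hgu (hsq g hg δ₁ hδ₁K)
  have hu₀' : u₀ ^ 2 + u₀ + 1 = 0 := by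
    have h' : (u₀ - 1) * (u₀ ^ 2 + u₀ + 1) = 0 := by linear_combination hu₀
    exact (mul_eq_zero.mp h').resolve_left (sub_ne_zero.mpr hu₀1)
  have hg₀uu : g₀ • u = u ^ 2 := by
    rcases eq_or_eq_sq_of_pow_three_eq_one hu₀' hu hu1 with h | h
    · rw [h, hg₀u₀]
    · -- `g₀ (u₀²) = (u₀²)² = u₀⁴`
      rw [h, smul_pow', hg₀u₀, ← pow_mul]
  -- `h = g₀ g ∈ D_v` acts on `δ₁` by `u²` and fixes `u`, so `h² δ₁ = u⁴ δ₁ = u δ₁ ≠ δ₁`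
  have hhδ₁ : (g₀ * g) • δ₁ = u ^ 2 * δ₁ := by
    rw [mul_smul, hgu, smul_mul', hg₀uu, hg₀δ₁]
  have hhu : (g₀ * g) • u = u := by
    rw [mul_smul, hguu, smul_pow', hg₀uu, ← pow_mul, show 2 * 2 = 3 + 1 from rfl, pow_succ, hu,
      one_mul]
  have hh2 := hsq (g₀ * g) ((decomp (K := ℚ) v).mul_mem hg₀ hg) δ₁ hδ₁K
  rw [hhδ₁, smul_mul', smul_pow', hhu, hhδ₁, ← mul_assoc, ← pow_add,
    show 2 + 2 = 3 + 1 from rfl, pow_succ, hu, one_mul] at hh2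
  -- `u * δ₁ = δ₁` forces `u = 1`
  exact hu1 (mul_left_eq_self₀.mp hh2 |>.resolve_right hδ₁0)

/-- **`p = 3`: `Δ(W)` is a cube in the completion `ℚ_v` (`v ∋ 3`)** under the same hypotheses: the
`D_v`-fixed cube root `δ` of §3, carried to `ℚ̄_v` by the chosen embedding `ι`, is fixed by all of
`Γ_{ℚ_v}` (`ι(res σ · δ) = σ(ι δ)`, `res σ ∈ D_v`), hence lies in `ℚ_v` (Galois descent, Mathlib
`InfiniteGalois.mem_range_algebraMap_iff_fixed`); `(W.Δ : ℚ_v)` is the rational number `Δ(W)` cast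
into the completion. [cite: Serre1972, §5.3]
[cite: SilvermanATAEC1994, Ch. V Thm. 5.3, Cor. 5.4] -/
theorem exists_adicCompletion_pow_three_eq_Δ_of_lineUnramifiedAt_three {W : WeierstrassCurve ℚ}
    [W.IsElliptic] [W.IsGloballyMinimal] (hmult : W.HasMultiplicativeReductionAtPrime 3)
    {Φ : AddSubgroup (geomTorsion W ((3 : ℕ) : ℤ))} (hΦ : IsRationalLine W 3 Φ)
    (hunr : LineUnramifiedAt W 3 Φ) {v : HeightOneSpectrum (𝓞 ℚ)}
    (hpv : ((3 : ℕ) : 𝓞 ℚ) ∈ v.asIdeal) :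
    ∃ t : v.adicCompletion ℚ, t ^ 3 = (W.Δ : v.adicCompletion ℚ) := by
  obtain ⟨δ, hδ, hfix⟩ := exists_cubeRoot_Δ_decomp_fix_of_lineUnramifiedAt_three hmult hΦ hunr hpv
  set ι : AlgebraicClosure ℚ →ₐ[ℚ] AlgebraicClosure (v.adicCompletion ℚ) :=
    closureEmb (K := ℚ) (v.adicCompletion ℚ) with hι
  -- `ι δ` is fixed by `Γ_{ℚ_v}`
  have hfixloc : ∀ σ : absoluteGaloisGroup (v.adicCompletion ℚ),
      (show AlgebraicClosure (v.adicCompletion ℚ) ≃ₐ[v.adicCompletion ℚ]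
        AlgebraicClosure (v.adicCompletion ℚ) from σ) (ι δ) = ι δ := fun σ ↦ by
    have hmem : absGaloisRestrict ℚ (v.adicCompletion ℚ) σ ∈ decomp (K := ℚ) v := by
      rw [mem_decomp_iff]; exact ⟨σ, rfl⟩
    have h1 := hfix _ hmem
    rw [← resGal_eq_absGaloisRestrict, resGal_eq, resGalOfEmb_apply] at h1
    -- `h1 : res σ • δ = δ`, i.e. `(res σ) δ = δ`; and `ι (res σ δ) = σ (ι δ)`
    have h2 := apply_resGalAuxOfEmb_apply ι σ δ
    have h3 : ι ((show AlgebraicClosure ℚ ≃ₐ[ℚ] AlgebraicClosure ℚ from resGalAuxOfEmb ι σ) δ) =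
        ι δ := congrArg ι h1
    exact h2.symm.trans h3
  have hι3 : (ι δ) ^ 3 = ((W.Δ : ℚ) : AlgebraicClosure (v.adicCompletion ℚ)) := by
    rw [← map_pow, hδ, AlgHom.commutes, eq_ratCast]
  -- Galois descent `(ℚ̄_v)^{Γ_{ℚ_v}} = ℚ_v` (the `CharZero` instance is introduced only now: it
  -- changes the inferred `ℚ`-algebra structures on `ℚ_v`, `ℚ̄_v`)
  haveI : CharZero (v.adicCompletion ℚ) := charZero_adicCompletion v
  haveI : IsGalois (v.adicCompletion ℚ) (AlgebraicClosure (v.adicCompletion ℚ)) := {}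
  obtain ⟨t, ht⟩ := (InfiniteGalois.mem_range_algebraMap_iff_fixed (ι δ)).mpr fun σ ↦ hfixloc σ
  refine ⟨t, ?_⟩
  apply (algebraMap (v.adicCompletion ℚ) (AlgebraicClosure (v.adicCompletion ℚ))).injective
  rw [map_pow, ht, hι3, map_ratCast]

/-- **`p = 3`: `Δ(W) ∈ (ℚ₃^×)³`** — for `W/ℚ` globally minimal with multiplicative reduction at `3`
and a rational `3`-line UNRAMIFIED at `3`, the discriminant `Δ(W) = Δ_min` is a cube in `ℚ₃`
(Mathlib `Padic.adicCompletionEquiv : ℚ_[3] ≃ ℚ_v`). Elementary reading: `3 ∣ v₃(Δ_min)` (the tree's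
`…EtaleEndAtP.dvd_padicValInt_minimalDiscriminantInt_of_lineUnramifiedAt_of_mult`) AND the unit part
of `Δ_min` is `≡ ±1 (mod 9)`. A division-polynomial-free necessary test for «which member of the
isogeny class is the étale end». [cite: Serre1972, §5.3] [cite: SilvermanATAEC1994, Ch. V Thm. 5.3, Cor. 5.4] -/
theorem exists_padic_pow_three_eq_Δ_of_lineUnramifiedAt_three {W : WeierstrassCurve ℚ}
    [W.IsElliptic] [W.IsGloballyMinimal] (hmult : W.HasMultiplicativeReductionAtPrime 3)
    {Φ : AddSubgroup (geomTorsion W ((3 : ℕ) : ℤ))} (hΦ : IsRationalLine W 3 Φ)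
    (hunr : LineUnramifiedAt W 3 Φ) : ∃ t : ℚ_[3], t ^ 3 = (W.Δ : ℚ_[3]) := by
  obtain ⟨t, ht⟩ := exists_adicCompletion_pow_three_eq_Δ_of_lineUnramifiedAt_three hmult hΦ hunr
    (KernelDisc.natCast_mem_asIdeal_primesEquiv_symm (p := 3))
  refine ⟨(Padic.adicCompletionEquiv (R := 𝓞 ℚ) ⟨3, Fact.out⟩).toAlgEquiv.symm t, ?_⟩
  rw [← map_pow, ht, map_ratCast]


/-! ## §2 The ÉTALE END of an X2 class at `p = 3`: `Δ_min ∈ (ℚ₃^×)³` (rows A10 = X2b and B11 = X2c);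
members whose `Δ_min` is not a `3`-adic cube lie ON the barrier locus -/

/-- **Type A, any rank: off the barrier locus at `p = 3`, `Δ(W) ∈ (ℚ₃^×)³`.** For `W/ℚ` globally
minimal, multiplicative at `3`, `E[3]` reducible of type A (`¬ GVPar`) and no ramified-odd rational
`3`-line — the ÉTALE END of an X2b or X2c class at `3` —: the rational line is unramified-even
(`…EtaleEndAtP.lineUnramifiedAt_of_offLocus`) and §3 applies. Census of record (-w2 g4 ADDENDUM,
Cremona `allcurves`): the 147 étale-side members of the 127 A10 classes all have `Δ_min ∈ (ℚ₃^×)³`,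
against 10 of the 150 on-locus members. [cite: Serre1972, §5.3] [cite: GreenbergVatsal2000, §2 p. 28] -/
theorem exists_padic_pow_three_eq_Δ_of_notGVPar_offLocus {W : WeierstrassCurve ℚ} [W.IsElliptic]
    [W.IsGloballyMinimal] (hmult : W.HasMultiplicativeReductionAtPrime 3)
    (hred : ¬ W.HasIrreducibleModPGaloisRep 3) (hA : ¬ GVPar W 3) (hoff : ¬ HasRamifiedOddLineAt W 3) :
    ∃ t : ℚ_[3], t ^ 3 = (W.Δ : ℚ_[3]) := by
  obtain ⟨Φ, hΦ⟩ := exists_isRationalLine_of_not_irr W 3 hred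
  exact exists_padic_pow_three_eq_Δ_of_lineUnramifiedAt_three hmult hΦ
    (EisensteinPrimesMazurMCOnCellBEtaleEndAtP.lineUnramifiedAt_of_offLocus hA hoff hΦ).1

/-- **Every X2b ÉTALE END at `p = 3` (row A10, crux `MazurMCOnCellB`) has `Δ_min ∈ (ℚ₃^×)³`** — the
`X2.CellB` packaging: the member `(W₀, 3)` at which `mudescent`'s stubs 3′/4″ are stated satisfies a
one-line `3`-adic test with no division polynomial. [cite: Serre1972, §5.3] [cite: GreenbergVatsal2000, §2 p. 28] -/
theorem exists_padic_pow_three_eq_Δ_of_cellB_offLocus {W : WeierstrassCurve ℚ} [W.IsElliptic]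
    [W.IsGloballyMinimal] (hc : X2.CellB W 3) (hoff : ¬ HasRamifiedOddLineAt W 3) :
    ∃ t : ℚ_[3], t ^ 3 = (W.Δ : ℚ_[3]) :=
  exists_padic_pow_three_eq_Δ_of_notGVPar_offLocus hc.2.1.2.2 hc.2.1.2.1 hc.2.2 hoff

/-- **X2c (row B11, crux `BSDpOnCellC`), type A, off the locus at `p = 3`: `Δ_min ∈ (ℚ₃^×)³`.**
[cite: Serre1972, §5.3] [cite: GreenbergVatsal2000, §2 p. 28] -/
theorem exists_padic_pow_three_eq_Δ_of_cellC_offLocus {W : WeierstrassCurve ℚ} [W.IsElliptic]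
    [W.IsGloballyMinimal] (hc : X2.CellC W 3) (hA : ¬ GVPar W 3) (hoff : ¬ HasRamifiedOddLineAt W 3) :
    ∃ t : ℚ_[3], t ^ 3 = (W.Δ : ℚ_[3]) :=
  exists_padic_pow_three_eq_Δ_of_notGVPar_offLocus hc.2.2.2 hc.2.2.1 hA hoff

/-- **A type-A X2 member at `p = 3` whose `Δ_min` is NOT a `3`-adic cube lies ON the barrier locus**
(`HasRamifiedOddLineAt W 3`; so `μ(X(E/ℚ_∞)) ≥ 1` there, next theorem) — it is never the étale end.
[cite: GreenbergLNM1716, Prop. 5.7 (p. 113)] [cite: Serre1972, §5.3] -/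
theorem hasRamifiedOddLineAt_of_not_cube {W : WeierstrassCurve ℚ} [W.IsElliptic]
    [W.IsGloballyMinimal] (hmult : W.HasMultiplicativeReductionAtPrime 3)
    (hred : ¬ W.HasIrreducibleModPGaloisRep 3) (hA : ¬ GVPar W 3)
    (hn : ¬ ∃ t : ℚ_[3], t ^ 3 = (W.Δ : ℚ_[3])) : HasRamifiedOddLineAt W 3 := by
  by_contra hoff
  exact hn (exists_padic_pow_three_eq_Δ_of_notGVPar_offLocus hmult hred hA hoff)

/-- **`Δ_min ∉ (ℚ₃^×)³` ⟹ `μ(X(E/ℚ_∞)) ≥ 1`** for a type-A X2 member at `p = 3` and every torsion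
cyclotomic Selmer dual datum — relative to Greenberg's Prop. 5.7 (tree fact
`Greenberg1999.prop57_one_le_mu_of_ramified_odd_line`) through the barrier theorem
`EisensteinMuBarrier.one_le_mu`. A second free census column next to `3 ∤ v₃(Δ_min)`
(`…EtaleEndAtP.one_le_mu_of_notGVPar_of_not_dvd`): it also catches members with `3 ∣ v₃(Δ_min)` but
unit part `≢ ±1 (mod 9)`. [cite: GreenbergLNM1716, Prop. 5.7 (p. 113)] [cite: Serre1972, §5.3] -/
theorem one_le_mu_of_notGVPar_of_not_cube (h57 : Greenberg1999.prop57_one_le_mu_of_ramified_odd_line)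
    {W : WeierstrassCurve ℚ} [W.IsElliptic] [W.IsGloballyMinimal]
    (hmult : W.HasMultiplicativeReductionAtPrime 3) (hred : ¬ W.HasIrreducibleModPGaloisRep 3)
    (hA : ¬ GVPar W 3) (hn : ¬ ∃ t : ℚ_[3], t ^ 3 = (W.Δ : ℚ_[3]))
    {κ : ZpExtension ℚ 3} {γ : Field.absoluteGaloisGroup ℚ} (hκ : κ.IsCyclotomic)
    (hγ : κ.IsTopGenerator γ) (D : W.SelmerDualData κ γ) [Module.Finite (IwasawaAlgebra 3) D.X]
    (hD : D.IsTorsion) : 1 ≤ D.mu :=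
  EisensteinMuBarrier.one_le_mu h57 (by decide) (Or.inr hmult)
    (hasRamifiedOddLineAt_of_not_cube hmult hred hA hn) hκ hγ D hD

end Summit.BirchSwinnertonDyer.BirchSwinnertonDyer.Theorems.EisensteinPrimesMazurMCOnCellBEtaleEndCube

end
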